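import Literature.Topology.FourManifolds.PropertyRStrictOne
import Literature.Topology.FourManifolds.RLinkSphere
import HarnessLib

/-!
# Helper `helper_stdSphereSlides_one_of_gabai` of line `sphere_split` for crux
`VerlindeRLinks.VrlSliceRigidity` (item stmt-SmoothPoincare4-16179, route route-SmoothPoincare4-VerlindeRLinks)

**The slice `n = 1` of the heart `stub_stdSphereSlides` ("generalised Property R on the standard
`S⁴`") is Gabai's Property R.** Gompf–Scharlemann–Thompson (2010), §2: *"In the case `n = 1` no
slides are possible, so Conjecture 1 does indeed directly generalize Theorem 1.1"*, and Theorem 1.1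
is Property R (D. Gabai, J. Differential Geom. 26 (1987), Cor. 8.3 with Remark 8.5: `0`-framed
surgery on `K` is `S¹ × S²` only for the unknot). The Literature theorem
`Literature.Topology.FourManifolds.strictGeneralizedPropertyRConjecture_one_of_gabai`
(`PropertyRStrictOne.lean`) proves the slice `n = 1` of the printed conjecture
`StrictGeneralizedPropertyRConjecture` from Gabai's Corollary 8.3 in the tree's form (the named
fact `Knot.hasSeifertSurfaceOfGenus_le_of_isIntegralSurgery_zero`, genus clause, taken as a
hypothesis; everything else — `#¹(S² × S¹)` is `0`-surgery on the unknot, `H₁ ≅ ℤ` forces the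
framing `0` (GST Prop. 2.2), the nonseparating sphere, "a knot bounding a disc is trivial" — is
proved in the tree): if surgery on a one-component framed link `L = (K, m)` is `#¹(S² × S¹)` then
`m = 0`, `K` is the unknot, and `L` is one isotopy move away from the `0`-framed unknot, a
`0`-framed unlink. This helper restates it in the shape of the heart at `n = 1` (the two sphere
hypotheses of the heart are not even needed, exactly as for `helper_stdSphereSlides_of_strictGPRC`).

Why it is recorded: with `helper_stdSphereSlides_zero` (`n = 0`, trivial) it confines the open
content of the heart to `n ≥ 2` (Property 2R and beyond; Gompf–Scharlemann–Thompson §3: "Almost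
nothing is known about Generalized Property R"), conditionally only on Gabai's theorem, a KNOWN
result vendored as a named fact.

Sources: D. Gabai, *Foliations and the topology of 3-manifolds. III*, J. Differential Geom. 26
(1987) 479–536, Cor. 8.3, Remark 8.5 [GabaiJDG1987]; R. E. Gompf, M. Scharlemann, A. Thompson,
*Fibered knots and potential counterexamples to the Property 2R and Slice-Ribbon Conjectures*,
Geom. Topol. 14 (2010), §2 (case `n = 1`), Thm. 1.1, Prop. 2.2 [GompfScharlemannThompson2010];
R. Kirby (ed.), *Problems in low-dimensional topology* (1997), Problem 1.82 [Kirby1997].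

The file declares one theorem (an application of the Literature theorem) and no notation (the
model space `EuclideanSpace ℝ (Fin 3)` is written out).
-/

noncomputable section

set_option linter.dupNamespace false

namespace Summit.SmoothPoincare4.SmoothPoincare4.Theorems.VrlSliceRigidity.SphereSplit

open scoped Manifold ContDiff Topology
open Set Function Literature.Topology.FourManifolds

/-- **The slice `n = 1` of GPRC on the standard sphere is Property R** (registered helper
`helper_stdSphereSlides_one_of_gabai` of the heart `stub_stdSphereSlides`): GIVEN Gabai's
Corollary 8.3 in the tree's form (`Knot.hasSeifertSurfaceOfGenus_le_of_isIntegralSurgery_zero`),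
if surgery on a one-component framed link `L ⊂ S³` is a closed smooth `Y ≅ #¹(S² × S¹)`, then `L`
is strictly handle-slide equivalent to a `0`-framed unlink — by
`Literature.Topology.FourManifolds.strictGeneralizedPropertyRConjecture_one_of_gabai`
(Gompf–Scharlemann–Thompson (2010), §2 for `n = 1` and Thm. 1.1 = Gabai (1987), Cor. 8.3).
[cite: GompfScharlemannThompson2010, §2 (case n = 1) and Thm. 1.1] -/
theorem helper_stdSphereSlides_one_of_gabai : ∀ [Knot.TubularNbhd.SmoothnessFacts], Knot.hasSeifertSurfaceOfGenus_le_of_isIntegralSurgery_zero.{0} → ∀ (L : FramedLink (Fin 1)) (Y : Type) [TopologicalSpace Y] [T2Space Y] [SecondCountableTopology Y] [ChartedSpace (EuclideanSpace ℝ (Fin 3)) Y] [IsManifold (𝓡 3) ∞ Y] [CompactSpace Y] [ConnectedSpace Y], IsSphereTwoProdCircleSum 1 Y → L.IsSurgery (𝓡 3) Y → ∃ U : FramedLink (Fin 1), U.IsZeroFramedUnlink ∧ IsStrictHandleSlideEquivalent ⟨1, L⟩ ⟨1, U⟩ := by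
  intro _ h83 L Y _ _ _ _ _ _ _ hY hL
  exact strictGeneralizedPropertyRConjecture_one_of_gabai h83 L Y hY hL

end Summit.SmoothPoincare4.SmoothPoincare4.Theorems.VrlSliceRigidity.SphereSplit

end
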